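import Summits.CriticalPhenomena.PercolationContinuityZ3.Theorems.Transplant.SiteBurtonKeaneQT
import Summits.CriticalPhenomena.PercolationContinuityZ3.Theorems.Transplant.LineGraphSiteScope
import Summits.CriticalPhenomena.PercolationContinuityZ3.Theorems.Transplant.CubicLatticesAmenable
import Summits.CriticalPhenomena.PercolationContinuityZ3.Theorems.Transplant.ThetaContinuousStacks
import Literature.Barriers.CriticalPhenomena.BLPSCriticalReduction
import HarnessLib

/-!
# The uniqueness column for three SITE rows: pyrochlore, kagome, honeycomb — a.s. at most one infinite open site cluster, every `p`

builds on p205010 (kernel theorem, internal audit signed; external expert review pending) — NOT used in this file.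
Lane `prim-bschramm`, seat `prim-bschramm-p2` gen 17 (class C1b); helper file (`--supports stmt-CriticalPhenomena-4575 --as helper`).

The class map's SITE rows (pyrochlore = `L(diamond)`, kagome = `L(honeycomb)`, honeycomb) had their "uniqueness ∀ p" cell recorded as
"via p1's `SiteBurtonKeaneQT` where quasi-transitive amenable (not instantiated)".  Instantiated here: amenability of the pyrochlore lattice
(`(distSqGraph 3 2).induce pyrochloreSite`, cubic growth: `distSqGraph_induce_isGraphAmenable`), of the kagome and honeycomb lattices
(quadratic growth: `kagomeGraph_not_hasExponentialGrowth`, `hexGraph_not_hasExponentialGrowth` of `ThetaContinuousStacks`), and the site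
Burton–Keane theorem `sitePercolation_ae_unique_infinite_siteCluster_of_isGraphAmenable` (p1 lineage).
* `pyrochlore_isGraphAmenable`, **`pyrochlore_site_uniqueness`**; `kagome_isGraphAmenable`, **`kagome_site_uniqueness`**;
  `honeycomb_isGraphAmenable`, **`honeycomb_site_uniqueness`**; and the bond twins (`…_bond_uniqueness`, Burton–Keane).
[cite: BurtonKeane1989, Thm. 2] [cite: Haggstrom2011, Thm. 2.6] [cite: BenjaminiSchramm1996, §4 (after Conj. 5)] -/

noncomputable section

namespace Summit.CriticalPhenomena.PercolationContinuityZ3.Theorems.Transplant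

namespace SiteUniqRows

open MeasureTheory Literature.Probability.Percolation Literature.Probability.LatticeModels SimpleGraph Filter
open Literature.Barriers.CriticalPhenomena Literature.MathematicalPhysics.QuantumLattice SiteUniqQT ThetaContStacks
open scoped Classical Topology

/-! ## §1 The pyrochlore lattice -/

/-- **The pyrochlore lattice is amenable** (cubic growth inside `ℤ³`). [cite: BenjaminiSchramm1996, §4 (after Conj. 5)] [cite: LyonsPeres2016, §6.1] -/
theorem pyrochlore_isGraphAmenable : IsGraphAmenable pyrochloreGraph :=
  distSqGraph_induce_isGraphAmenable (by norm_num) pyrochloreSite pyrochloreOrigin pyrochlore_isQuasiTransitive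

/-- **Uniqueness of the infinite open SITE cluster on the pyrochlore lattice, every `p`**: a.s. any two sites with infinite open site
clusters are joined by a path of open sites (site Burton–Keane on the connected, quasi-transitive, amenable pyrochlore graph).
[cite: BurtonKeane1989, Thm. 2] [cite: Haggstrom2011, Thm. 2.6] -/
theorem pyrochlore_site_uniqueness (p : unitInterval) :
    ∀ᵐ σ ∂(sitePercolation pyrochloreSite p), ∀ x y, (siteCluster pyrochloreGraph σ x).Infinite →
      (siteCluster pyrochloreGraph σ y).Infinite → (siteOpenGraph pyrochloreGraph σ).Reachable x y :=
  sitePercolation_ae_unique_infinite_siteCluster_of_isGraphAmenable pyrochloreGraph_connected pyrochlore_isQuasiTransitive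
    pyrochlore_isGraphAmenable p

/-- **Uniqueness of the infinite open BOND cluster on the pyrochlore lattice, every `p`** (Burton–Keane). [cite: BurtonKeane1989, Thm. 2] -/
theorem pyrochlore_bond_uniqueness (p : unitInterval) :
    ∀ᵐ ω ∂bondPercolation pyrochloreGraph p, numInfiniteClusters ω ≤ 1 :=
  BurtonKeane1989_atMostOneInfiniteCluster_holds pyrochloreGraph pyrochloreGraph_connected pyrochlore_isQuasiTransitive
    pyrochlore_isGraphAmenable p

/-! ## §2 The kagome lattice -/

/-- **The kagome lattice is amenable** (quadratic growth, `kagomeGraph_not_hasExponentialGrowth`). [cite: BenjaminiSchramm1996, §4 (after Conj. 5)] -/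
theorem kagome_isGraphAmenable : IsGraphAmenable kagomeGraph := by
  by_contra h
  exact kagomeGraph_not_hasExponentialGrowth (hasExponentialGrowth_of_not_isGraphAmenable _ kagome_isQuasiTransitive h)

/-- **Uniqueness of the infinite open SITE cluster on the kagome lattice, every `p`.** [cite: BurtonKeane1989, Thm. 2] [cite: Haggstrom2011, Thm. 2.6] -/
theorem kagome_site_uniqueness (p : unitInterval) :
    ∀ᵐ σ ∂(sitePercolation KagomeVertex p), ∀ x y, (siteCluster kagomeGraph σ x).Infinite →
      (siteCluster kagomeGraph σ y).Infinite → (siteOpenGraph kagomeGraph σ).Reachable x y :=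
  sitePercolation_ae_unique_infinite_siteCluster_of_isGraphAmenable kagomeGraph_connected kagome_isQuasiTransitive
    kagome_isGraphAmenable p

/-- **Uniqueness of the infinite open BOND cluster on the kagome lattice, every `p`.** [cite: BurtonKeane1989, Thm. 2] -/
theorem kagome_bond_uniqueness (p : unitInterval) :
    ∀ᵐ ω ∂bondPercolation kagomeGraph p, numInfiniteClusters ω ≤ 1 :=
  BurtonKeane1989_atMostOneInfiniteCluster_holds kagomeGraph kagomeGraph_connected kagome_isQuasiTransitive kagome_isGraphAmenable p

/-! ## §3 The honeycomb lattice -/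

/-- **The honeycomb lattice `hexGraph` is amenable** (quadratic growth, `hexGraph_not_hasExponentialGrowth`). [cite: BenjaminiSchramm1996, §4 (after Conj. 5)] -/
theorem honeycomb_isGraphAmenable : IsGraphAmenable hexGraph := by
  by_contra h
  exact hexGraph_not_hasExponentialGrowth (hasExponentialGrowth_of_not_isGraphAmenable _ honeycomb_conj4_hypotheses.2.1 h)

/-- **Uniqueness of the infinite open SITE cluster on the honeycomb lattice, every `p`.** [cite: BurtonKeane1989, Thm. 2] [cite: Haggstrom2011, Thm. 2.6] -/
theorem honeycomb_site_uniqueness (p : unitInterval) :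
    ∀ᵐ σ ∂(sitePercolation HexVertex p), ∀ x y, (siteCluster hexGraph σ x).Infinite →
      (siteCluster hexGraph σ y).Infinite → (siteOpenGraph hexGraph σ).Reachable x y :=
  sitePercolation_ae_unique_infinite_siteCluster_of_isGraphAmenable honeycomb_conj4_hypotheses.1 honeycomb_conj4_hypotheses.2.1
    honeycomb_isGraphAmenable p

/-- **Uniqueness of the infinite open BOND cluster on the honeycomb lattice `hexGraph`, every `p`.** [cite: BurtonKeane1989, Thm. 2] -/
theorem honeycomb_bond_uniqueness (p : unitInterval) :
    ∀ᵐ ω ∂bondPercolation hexGraph p, numInfiniteClusters ω ≤ 1 :=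
  BurtonKeane1989_atMostOneInfiniteCluster_holds hexGraph honeycomb_conj4_hypotheses.1 honeycomb_conj4_hypotheses.2.1
    honeycomb_isGraphAmenable p

end SiteUniqRows

end Summit.CriticalPhenomena.PercolationContinuityZ3.Theorems.Transplant

end
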